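import Mathlib
import HarnessLib
import Summits.AtomisticToContinuum.HydrodynamicLimit.Theses.OneFlightGossipEngine
import Summits.AtomisticToContinuum.HydrodynamicLimit.Theorems.OneFlightGossipEngineLocalClampedTransferLDAlongFamiliesSAxisNet

/-!
# Skeleton v3 (ONE STUB) — crux `LocalClampedTransferLDAlongFamilies` (stmt-AtomisticToContinuum-17691),
# line `Sketch` (lead prover-line-stmt-AtomisticToContinuum-17691-0)

Line `Sketch` (ideator 2's card `shrinking-window-cell-transfer`, reshaped at L0 — `PICKED.md`): the crux (transfer-clamped
collisional window LD under the local Gibbs REFERENCE law, EOS-projected with x-frozen coefficients and centred, uniform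
along a jointly continuous profile family and a jointly smooth test family) differs from TwoClocks' equilibrium crux C′
(16623) along two axes, the family parameter `s` and the spatial inhomogeneity of the reference law. v1/v2 registered
`crux ⟸[s-axis] LCT♯ ⟸[x-axis] C⁺♯ ∧ MoverCensus`.

WHAT IS LANDED (all `--supports stmt-AtomisticToContinuum-17691`, namespace `…Theorems.LocalClampedTransferSketch`):
* the s-axis ENTIRELY: `stub_sAxisNet : LCTSharp → LocalClampedTransferLDAlongFamilies` (S5; finite net in `s`, static
  Rényi-2 change of law, pathwise Lipschitz continuity of the TRANSFER-clamped rows in the test function through the clamp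
  budget, one-body modulus of the x-frozen EOS projections with jointly continuous EOS fields, window-energy pricing,
  centring continuity) over its prelims S2 `stub_eosFieldFamilyModulus` (p145919), S3 `stub_windowEnergyExpMoment`
  (p146043), S4 `stub_clampedFunctionalMeasurable` (p146098), `stub_sAxisNetPrelim` (p145942), `stub_sAxisNetPathwise`
  (p145987), `stub_sAxisNetChain` (p146476), `stub_sAxisNetNode` (p147040, declares `LCTSharp`);
* of the x-axis: the card's first lemma `stub_moverCensus : MoverCensus` (S7, p145957).

WHAT v3 CHANGES. The x-axis transfer `C⁺♯ → MoverCensus → LCT♯` (v2's S6) is the card's research bet (influence census of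
the true-vs-periodised-cell discrepancy, static decoupling, recentring) and C⁺♯ (v2's S1) is TwoClocks' 16623 made
box-uniform — both conjecture-grade, neither consumable by a worker. v3 therefore registers the state the kernel certifies:
the crux is CLOSED MODULO THE SINGLE NODE `LCTSharp` (the profile-wise collisional node with NUMERIC clamp/tilt thresholds
`V₀(Θ,U,Λ,Lφ,σ)`, `β₀(Θ,U,Λ,Lφ,σ,V)`; `τ₀, N₀` after the profile and the test function), exactly as the kinetic twin
16659 ended modulo `KCWUSharpPlus`. `LCTSharp` is crux-sized: it implies TwoClocks' C′ `ClampedTransferWindowLD` (16623)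
through the crux and the landed constant-family rung (`stub_lctSharpImpliesRung`). The x-axis route to the node
(C⁺♯ = `CPlusSharp`, certificate `stub_cPlusImpliesRung : CPlusSharp → ClampedTransferWindowLD`; `MoverCensus` landed;
the census/decoupling/recentring stubs to be typed) stays recorded in `PICKED.md`, the card and the tree history of this
file (v1 cf8cbfba50ac) for the next ideation round.

```
LocalClampedTransferLDAlongFamilies_of :=
  stub_sAxisNet          -- S5 LANDED (s-axis net; ≈ 1 400 lines over eight landed files)
    stub_lctSharp        -- THE ONE OPEN STUB: LCT♯ (profile-wise node, numeric V₀ β₀) — crux-sized (⊇ 16623)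
```

Disproof.lean (cdisprove-17691 cycle 1): NO KILL, `Targets: none`; both Negative lemmas (energy impulse load-bearing; `V₀` not
after `τ`) are honoured by `LCTSharp` (full transfer activity; `V₀, β₀` before `τ₀`).
-/

noncomputable section

namespace Summit.AtomisticToContinuum.HydrodynamicLimit.Cruxes.LocalClampedTransferLDAlongFamilies.Sketch

open Summit.AtomisticToContinuum.HydrodynamicLimit.Theses.OneFlightGossipEngine (LocalClampedTransferLDAlongFamilies)
open Summit.AtomisticToContinuum.HydrodynamicLimit.Theorems.LocalClampedTransferSketch (LCTSharp stub_sAxisNet)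

/-! ## The open stub (the single dynamical input) -/

/-- S♯ — `LCTSharp`: THE PROFILE-WISE COLLISIONAL NODE WITH NUMERIC CLAMP/TILT THRESHOLDS (OPEN; declared in
`Theorems/OneFlightGossipEngineLocalClampedTransferLDAlongFamiliesSAxisNetNode.lean`). There is a packing guard `η₀ > 0` such
that for all data bounds `(Θ, U, Λ, Lφ)` and every `σ ∈ (0,1/2)` there are `V₀(Θ,U,Λ,Lφ,σ)` and, for `V ≥ V₀`,
`β₀(Θ,U,Λ,Lφ,σ,V) > 0` serving EVERY continuous profile triple within the two-sided bounds (packing guard by `η₀`), every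
flow family and every smooth test function with `|∂φ|, |∂∂φ| ≤ Lφ`: for `|β| ≤ β₀`, `ε > 0` there are `τ₀` and, for
`τ ≥ τ₀`, `N₀` beyond which the crux's four transfer-clamped, EOS-projected, centred window rows (its `let` block verbatim
for one profile / one test function) have exponential moments `≤ e^{ε(N+1)}` under `localGibbsLaw σ a u₀ θ₀ N (Φ N)`.
Contains the F1/F2 core of TwoClocks' 16623 (N-uniform window LD of transfer-clamped collisional currents over `τ → ∞` free
times; tagged transfer-activity LLN); necessary shape facts (Disproof.lean): the energy impulse in the activity, `V₀` before `τ`. -/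
theorem stub_lctSharp : LCTSharp := by
  sorry

/-! ## Composition -/

/-- The line closes the crux modulo its single stub: the LANDED s-axis net `stub_sAxisNet` applied to the node. This is the
only theorem of the file whose conclusion is the crux constant. -/
theorem LocalClampedTransferLDAlongFamilies_of : LocalClampedTransferLDAlongFamilies :=
  stub_sAxisNet stub_lctSharp

end Summit.AtomisticToContinuum.HydrodynamicLimit.Cruxes.LocalClampedTransferLDAlongFamilies.Sketch

end
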